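import Summits.NavierStokesRegularity.NavierStokesRegularity.Theorems.TypeICertificateLadderTargetStrainCubeRung
import Summits.NavierStokesRegularity.NavierStokesRegularity.Theses.CollapseReynoldsRungTwo
import HarnessLib

/-!
# Route `CollapseReynoldsRungTwo`, crux #2 `RungTwo` (stmt-NavierStokesRegularity-20229) — PROVED

The crux `RungTwo` of route `CollapseReynoldsRungTwo` is rung `X_2` of the collapse-Reynolds ladder:
every classical solution of the unforced Navier–Stokes system on `ℝ³ × [0,T)` (`ν, T > 0`), Leray–Hopf
from its rapidly decaying datum, whose dimensionless rate is eventually at most `2`,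
`√(T−t)‖u(t,x)‖ ≤ 2√ν` for all `x`, extends smoothly past `T`.

This is VERBATIM `DepletionLadder.StrainCube.rungTwo` of the landed
`Theorems/TypeICertificateLadderTargetStrainCubeRung.lean` (line `depletion-ladder` of crux `Target`,
stmt-1217): the depletion constant `κ = (√3+√6)/9 < 1/2` of the `L^∞`-constrained stretching inequality
`|∫⟪ω, Du ω⟫| ≤ κ‖u‖_∞‖ω‖₂‖∇ω‖₂` (Betchov–Miller + strain-cube interpolation) in the depleted enstrophy
Grönwall against Leray's `H¹` rate — no Liouville theorem, no level gap. The route's own plan for this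
crux (method-ceiling rung on `C² < 15/14` + exceedance zoom + Liouville on the band `(1.035, 2]`) is
not needed: the depletion constant lifts the method ceiling `√6 − √2 ≈ 1.035` of the `L^q`-vorticity
budgets to `18 − 9√3 ≈ 2.41 > 2` (`StrainCube.rung_of_le_sharp`).

* `collapseReynoldsRungTwo_rungTwo_proof : Theses.CollapseReynoldsRungTwo.RungTwo` — closes the item.
  Every level `0 < C ≤ 2.41` is `StrainCube.rung_of_le_sharp`; the Galilean form (rate of `u − c_t` for
  any constants `c_t`) is `DepletionLadder.hasSmoothExtensionPast_of_oscillationRate_le`; the log-integral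
  / most-times forms are in `…TargetAmplitudeRung.lean`, `…TargetMostTimesRung.lean`.

After this file the route's residual is `DescentToRungTwo ∧ NoTypeII` (its cruxes #3, #4), exactly the
position of line `depletion-ladder` on crux 1217 (`StrainCube.target_iff_descentToRungTwo`). [folklore]
-/

noncomputable section

open Set Filter Topology
open Literature.Analysis.FluidPDE

namespace Summit.NavierStokesRegularity.NavierStokesRegularity.Theorems

-- the problem directory repeats the summit name (`NavierStokesRegularity/NavierStokesRegularity`)
set_option linter.dupNamespace false


/-- **Crux `RungTwo` of route `CollapseReynoldsRungTwo` (stmt-NavierStokesRegularity-20229), proved**: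
rung `X_2` — eventual rate `√(T−t)‖u(t,x)‖ ≤ 2√ν` forces a classical extension past `T` — is the landed
`DepletionLadder.StrainCube.rungTwo` (depletion constant `(√3+√6)/9 · 2 < 1`). [folklore] -/
theorem collapseReynoldsRungTwo_rungTwo_proof :
    Summit.NavierStokesRegularity.NavierStokesRegularity.Theses.CollapseReynoldsRungTwo.RungTwo := by
  unfold Summit.NavierStokesRegularity.NavierStokesRegularity.Theses.CollapseReynoldsRungTwo.RungTwo
  exact DepletionLadder.StrainCube.rungTwo

end Summit.NavierStokesRegularity.NavierStokesRegularity.Theorems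

end
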